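import Literature.Barriers.AtomisticToContinuum.MazurBoundBallistic
import Mathlib.Analysis.CStarAlgebra.Matrix
import Mathlib.Analysis.SpecialFunctions.Integrals.Basic
import HarnessLib

/-!
# Narrowed barrier `MazurBoundBallisticNarrow` (barrier audit of `MazurBoundBallistic`, 2026-08-15)

`Literature/Barriers/AtomisticToContinuum/` (D-0021 barrier catalogue), sub-problem `FouriersLaw`
(`Literature.MathematicalPhysics.KineticTheory.HeatConduction.FouriersLaw`: Fourier's law
`κ(T) = lim_N N · lim_{δT→0} J_N/δT ∈ (0, ∞)` for the pinned anharmonic chain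
`pinnedChain ω₂ lam β γ` between Langevin baths). Companion of `MazurBoundBallistic.lean`, whose
BARRIER block rides on the PROVED theorem `Mazur1969_inequality` (Mazur 1969 / Suzuki 1971 in
Hilbert-space form: for a strongly continuous contraction semigroup `U t`, `t ≥ 0`, on a real
Hilbert space, `lim_τ τ⁻¹∫₀^τ ⟪U t A, A⟫ dt = ‖P A‖²`, `P` the orthogonal projection onto the
conserved vectors, `≥ ∑ ⟪A, Q_i⟫²/‖Q_i‖²` for orthogonal conserved `Q_i`; corollary
`Mazur1969_inequality.tendsto_integral_atTop`: ONE conserved `Q` with `⟪A, Q⟫ ≠ 0` makes the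
Green–Kubo integral `∫₀^τ ⟪U t A, A⟫ dt` tend to `+∞` linearly).

The audit (refuter, 2026-08-15) re-read Lepri–Livi–Politi 2003 §5.2, §6.2 and §8 (arXiv pp. 22,
29, 36), Rigol–Shastry 2008 (abstract, pp. 2–3), Doyon 2022 (§1, Thm 2.2, §5.1 Thm 5.1),
Dhar–Kundu–Saito 2021 (§3, §4.3–4.4, §5), Bernardin–Huveneers 2013 (§1, §2.2 Thm 1 with its
Remarks, §4 Lemma 1 with its Remarks) and Di Cintio–Iubini–Lepri–Livi 2018 (abstract, §2, §3,
§5). It found the catalogued theorems correct and the obstruction CONFIRMED for what the printed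
sources actually use it for — periodic (or infinite) chains carrying an extensive conserved
quantity ODD under momentum reversal: the Toda chain's `Q₃, Q₅, …` ("`Q_n` with even `n` are
uncoupled with `J̃`, so that it suffices to consider odd values of `n`" [LepriLiviPoliti2003, §8]),
the ordered harmonic ring's current `J` itself, the momentum at non-zero pressure — but the
catalogued `technique_class` ("green-kubo current-autocorrelation-decay conservation-law-blind
integrability-blind momentum-conservation-blind … arguments … that do not exclude a conserved
quantity `Q` of the bulk dynamics with `⟨JQ⟩ ≠ 0`") and `blocks` (a) ("finite Green–Kubo
conductivity / bounded `κ_N` for chains with integrable bulk") too broad in the formalisable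
respects below. Each is isolated as a PROVED statement about contraction semigroups (no chain is
built, exactly as in the catalogued entry, whose dictionary `E = L²(μ_eq)`, `U t A = A ∘ φ_t`,
`⟨A(t)B(0)⟩ = ⟪U t A, B⟫` is kept):

1. SUZUKI'S EQUALITY IS EXACT, SO THE OBSTRUCTION IS EXACTLY `P J ≠ 0` (conjunct (2),
   `Mazur.starProjection_eq_zero_iff_forall_inner`, `Mazur.tendsto_inv_mul_integral_inner_zero`,
   `Mazur.tendsto_integral_inner_atTop_of_exists`). `P A = 0` iff `A` is orthogonal to every
   conserved vector, and then the Cesàro mean of the autocorrelation tends to `0`: the mechanism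
   is silent (it never speaks about SUB-linear growth of the Green–Kubo integral, i.e. anomalous
   transport, in either direction — which is why "momentum conservation ⇒ anomalous" is not a
   consequence of it, as the catalogued `scope_caveats` already say). Neither "integrable" nor
   "has conservation laws" is the hypothesis; `⟪J, Q⟫ ≠ 0` for some conserved `Q` is.

2. PARITY (conjunct (3), `Mazur.starProjection_eq_zero_of_reversing`). The energy current is odd
   under momentum reversal `R : p ↦ -p`, a unitary Koopman symmetry of every reversible
   equilibrium dynamics mapping conserved vectors to conserved vectors. If every conserved vector
   is `R`-EVEN then `P J = 0`: `‖P J‖² = ⟪J, P J⟫ = ⟪R J, R P J⟫ = -⟪J, P J⟫`. In print: "`A_2`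
   [the Toda energy current] is odd under time reversal which has non-zero overlap with odd
   conserved charges or products of conservation charges which are odd" [DharKunduSaito2021,
   §4.4]. Systems all of whose conserved vectors are even: reversible dynamics ergodic on energy
   shells (invariant functions are functions of `H`); harmonic networks with pairwise distinct
   positive normal frequencies — every OPEN harmonic chain with positive-definite force matrix
   (pinned, or fixed ends), ordered or not, that matrix being a Jacobi matrix with simple
   spectrum — on which every quadratic form odd in the momenta, such as the
   current, has zero time average along every orbit (design notes), and whose invariant functions
   are functions of the mode energies when the frequencies are non-resonant (the setting "we will
   assume that the spectrum `Ω_k` is non-degenerate" of [DharKunduSaito2021, §4.3]); in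
   particular the disordered pinned harmonic chain: "an integrable system"
   [BernardinHuveneers2013, §1; §4 Lemma 1 Remark 2: "the unperturbed dynamics is integrable,
   meaning here that it can be decomposed into `N` ergodic components"] which "behaves like a
   perfect insulator" [ibid., §2.2 Thm 1 Remark 1] and whose steady current between baths decays
   exponentially in `N` [Dhar2008, §3.4.1]. INTEGRABLE AND MAZUR-SILENT: what fires the bound in
   the ordered ring and in Toda is an odd extensive conserved quantity (the ring's `J`, from the
   `k ↔ -k` travelling-wave degeneracy; `Q₃`; `P` at non-zero pressure), not integrability.

3. COBOUNDARY CURRENTS (conjunct (4), `Mazur.starProjection_eq_zero_of_coboundary`,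
   `Mazur.abs_integral_inner_le_of_coboundary`). If `∫₀^τ U t A dt = U τ X - X` for `τ ≥ 0`
   (`A = LX`, a time derivative along the flow) then `P A = 0` AND the Green–Kubo integral is
   BOUNDED: `|∫₀^τ ⟪U t A, A⟫ dt| ≤ 2‖X‖‖A‖`. On every finite OPEN chain (free or fixed ends —
   the isolated bulk of the tree's `OscillatorChain` geometry, in particular of
   `pinnedChain ω₂ lam β γ` for ALL parameters, harmonic corner included) the total current IS
   such a derivative: summing the local energy balance `ḣ_i = j_{i-1,i} - j_{i,i+1}`
   (`j_{0,1} = j_{N,N+1} = 0`) by parts, `J = ∑_{i<N} j_{i,i+1} = (d/dt) ∑_i i·h_i`, whatever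
   `U`, `V`, `N`. So the catalogued corollary has NO instance `A = J` on any finite open chain,
   integrable (harmonic, Toda interaction) or not: its instances live on rings (periodic b.c.,
   where `∑ i·h_i` is not single-valued and `J = Ẋ + N·j_{N,1}`) or in infinite volume. The
   quantum form (`Ĵ = i[X̂, Ĥ]`) is printed: "for systems with open boundary conditions, it can
   be shown that the coefficient of the zero frequency delta peak is identically zero for any
   finite system, regardless of its integrability" [RigolShastry2008, Abstract; p. 2]; and for
   the localised chain the antiderivative is even bounded uniformly in `N`: "`-A_har u_N =
   J_{N,har}`" with "`(u_N)` … bounded sequences in `L²`" [BernardinHuveneers2013, §4 Lemma 1],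
   whence "the current integrated over arbitrarily long times remains bounded in `L²`" [ibid.,
   Thm 1 Remark 1]. Consequence for `blocks` (a): the ballistic conduction of the harmonic member
   `pinnedChain ω₂ 0 0 γ` (companion `HarmonicCrystalBallistic`) is NOT an instance of the
   catalogued mechanism at any finite `N` (its isolated bulk has zero Drude weight); "no proof of
   `FouriersLaw` uniform in `lam, β ≥ 0`" stands, but on the RLL/Nakazawa solution.

4. FIXED SIZE VERSUS THERMODYNAMIC LIMIT (conjunct (5), `Mazur.FixedSize.fixedSize_schema`). The
   catalogued theorems concern ONE system (`τ → ∞` at fixed `E, U, A`); `blocks` (a)–(b) concern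
   `N → ∞`, and the Green–Kubo conductivity takes `N → ∞` FIRST: "`κ_GK = (1/k_BT²) lim_{t→∞}
   ∫₀ᵗ dτ lim_{V→∞} V⁻¹⟨J(τ)J(0)⟩` … the infinite-volume limit should be taken before the
   long-time limit, in order to avoid the problem of Poincaré recurrences" [LepriLiviPoliti2003,
   §5.2]; the link "nonzero flux autocorrelation at arbitrarily large times ⇒ finite-size
   conductivity diverges linearly" goes through the infinite-volume autocorrelation and the
   transit-time cut-off `Na/v_s` [ibid., §6.2 and §8]. The schema (proved on `ℝ²`,
   `U t = diag(e^{-t⁺}, 1)`): observables `A_N` for which the catalogued corollary fires at EVERY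
   `N` (Drude weight `(N+1)⁻² > 0`, Green–Kubo integral `→ ∞` linearly) while
   `lim_N ∫₀^τ ⟪U t A_N, A_N⟫ dt = 1 - e^{-τ} → 1`, a finite positive "conductivity". In print: on
   rings "`D_L` and `D*_L` are found to be nonzero in integrable systems …, whereas [they] are
   expected to exponentially vanish with the system size for nonintegrable systems"
   [RigolShastry2008, p. 2]; for the periodic Toda chain the finite-`N` Suzuki value exceeds the
   Mazur bound from `{Q_n}` by products of charges, the deficit "decreases as `1/N`", "plausible
   that the equality … is obtained in the thermodynamic limit. We are not aware of a proof"
   [DharKunduSaito2021, §4.4 and §5]; rigorously, in infinite volume "the Drude weight exists and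
   is obtained by projecting onto the space of conserved charges" — the EXTENSIVE (pseudolocal)
   charges; "Only homogeneous conserved charges contribute"; "Effects due to finite volumes of
   space are avoided by the use of the algebraic formulation"; and "the problem of
   finite-dimensionality [of that space] is nontrivial in non-integrable models. Perhaps the most
   important open problem" [Doyon2022, §5.1 Thm 5.1 and §1] (quantum spin chains). What obstructs
   a finite `κ_GK` is therefore an extensive odd conserved charge of the infinite-volume (or
   periodic, uniformly in `N`) dynamics with `lim inf_N N⁻¹∑⟨J_NQ_n⟩²/⟨Q_n²⟩ > 0` — elementary
   for the periodic Toda chain in the pressure ensemble (product measure, local `Q₃`) [Zotos2002,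
   §2] [LepriLiviPoliti2003, §8]; nothing of the kind is known or expected for the pinned
   anharmonic chain: for the Toda interaction itself "the presence of the pinning potential is
   expected to destroy the integrability …, while leaving only one conserved quantity: the total
   energy", the maximal Lyapunov exponent is positive for every pinning power, and long chains
   show "normal (diffusive) conductivity" [DicintioEtAl2018, §2, §3, Abstract].

5. EXACT SUBTRACTION (conjunct (6), `Mazur.norm_sq_starProjection_eq_add`): for conserved
   `Q ≠ 0`, `‖P A‖² = ‖P Ã‖² + ⟪A, Q⟫²/‖Q‖²` with `Ã = A - (⟪A, Q⟫/‖Q‖²)Q ⊥ Q` — "equivalent to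
   removing the contribution of `Q₁` in the right hand side of the Mazur inequality"
   [LepriLiviPoliti2003, §8]: Prosen–Campbell's divergence (catalogued `blocks` (b)) is EXACTLY
   the momentum term, and momentum conservation says nothing about `‖P J̃‖²` (evasion (ii) of the
   catalogued block, made exact).

This file records the sharpened barrier `MazurBoundBallisticNarrow` with all conjuncts PROVED
(`MazurBoundBallisticNarrow_holds`): (1) the catalogued Mazur–Suzuki statement with the value of
the limit; (2) silence/dichotomy; (3) parity; (4) coboundary; (5) fixed-size schema; (6) exact
subtraction. `Mazur1969_inequality_of_narrow` recovers the catalogued statement.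

## Design notes

* Conjuncts (1)–(4), (6) are universally quantified over real Hilbert spaces `E : Type u` and
  over `Mazur.IsContractionSemigroup U` (the catalogued hypothesis structure); conjunct (5) is a
  witness on `EuclideanSpace ℝ (Fin 2)` built with `Matrix.toEuclideanCLM (diagonal ![e^{-t⁺}, 1])`.
  No chain, flow or Gibbs measure is constructed: the chain-level instances (open-chain
  coboundary `J = (d/dt)∑ i·h_i`; "all invariants even" for non-degenerate harmonic networks —
  along `Q_k(t) = Q_k cos ω_kt + P_k ω_k⁻¹ sin ω_kt` (all `ω_k > 0`, pairwise distinct) the time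
  averages of `Q_kP_l` (`k ≠ l`) and of `Q_kP_k` vanish, so every quadratic form odd in the
  momenta has zero time average on every orbit; `R = (p ↦ -p)^*` on `L²(μ_eq)`; Bernardin–Huveneers' `u_N`) are informal or cited,
  like the catalogued entry's dictionary. A logical separation, not a construction.
* The coboundary hypothesis is the integrated (mild) form `∫₀^τ U t A = U τ X - X`, which a `C¹`
  orbit `t ↦ U t X` with derivative `U t A` gives by the fundamental theorem of calculus, and
  which does not presuppose `U 0 = 1` (not part of `IsContractionSemigroup`).
* No named fact is introduced (D-0026): `MazurBoundBallisticNarrow` is a `def … : Prop` proved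
  here; the single universe parameter `u` also indexes the families `ι` of conjunct (1).
-/

noncomputable section

open MeasureTheory Filter Topology intervalIntegral
open scoped RealInnerProductSpace

namespace Literature.Barriers.AtomisticToContinuum

namespace Mazur

variable {E : Type*} [NormedAddCommGroup E] [InnerProductSpace ℝ E] [CompleteSpace E]
  {U : ℝ → E →L[ℝ] E}

/-! ### Silence: the bound fires iff `A` overlaps a conserved vector -/

omit [CompleteSpace E] in
/-- `⟪A, P A⟫ = ‖P A‖²` for an orthogonal projection `P`. [folklore] -/
theorem inner_starProjection_self (K : Submodule ℝ E) [K.HasOrthogonalProjection] (A : E) :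
    ⟪A, K.starProjection A⟫ = ‖K.starProjection A‖ ^ 2 := by
  have hmem : K.starProjection A ∈ K := Submodule.starProjection_apply_mem K A
  have horth : A - K.starProjection A ∈ Kᗮ := Submodule.sub_starProjection_mem_orthogonal A
  calc ⟪A, K.starProjection A⟫
      = ⟪(A - K.starProjection A) + K.starProjection A, K.starProjection A⟫ := by
        rw [sub_add_cancel]
    _ = ⟪A - K.starProjection A, K.starProjection A⟫
        + ⟪K.starProjection A, K.starProjection A⟫ := inner_add_left _ _ _
    _ = 0 + ‖K.starProjection A‖ ^ 2 := by
        rw [Submodule.inner_left_of_mem_orthogonal hmem horth, real_inner_self_eq_norm_sq]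
    _ = ‖K.starProjection A‖ ^ 2 := zero_add _

/-- The projection of `A` on the conserved vectors vanishes iff `A` is orthogonal to every
conserved vector (`⟨A Q⟩ = 0` for all constants of motion `Q`). [folklore] -/
theorem starProjection_eq_zero_iff_forall_inner (A : E) :
    (invariantSubspace U).starProjection A = 0 ↔ ∀ Q ∈ invariantSubspace U, ⟪A, Q⟫ = 0 := by
  rw [Submodule.starProjection_apply_eq_zero_iff, Submodule.mem_orthogonal']

/-- **Where Mazur's bound is silent.** If `A` is orthogonal to every conserved vector, the
Cesàro mean of its autocorrelation tends to `0`: the Green–Kubo integral `∫₀^τ ⟪U t A, A⟫ dt`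
is `o(τ)` and the mechanism "conserved quantity ⇒ linear growth" does not act (it says nothing
about sub-linear growth, i.e. anomalous transport). [folklore] -/
theorem tendsto_inv_mul_integral_inner_zero (hU : IsContractionSemigroup U) (A : E)
    (hA : ∀ Q ∈ invariantSubspace U, ⟪A, Q⟫ = 0) :
    Tendsto (fun τ : ℝ => τ⁻¹ * ∫ t in (0 : ℝ)..τ, ⟪U t A, A⟫) atTop (𝓝 0) := by
  have h := tendsto_inv_mul_integral_inner hU A
  rwa [(starProjection_eq_zero_iff_forall_inner A).mpr hA, norm_zero,
    zero_pow two_ne_zero] at h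

/-- **Where Mazur's bound fires.** If `A` overlaps some conserved vector, the Green–Kubo integral
tends to `+∞` (linearly); restatement of `Mazur1969_inequality.tendsto_integral_atTop` as the
other half of the dichotomy. [folklore] -/
theorem tendsto_integral_inner_atTop_of_exists (hU : IsContractionSemigroup U) (A : E)
    (hA : ∃ Q ∈ invariantSubspace U, ⟪A, Q⟫ ≠ 0) :
    Tendsto (fun τ : ℝ => ∫ t in (0 : ℝ)..τ, ⟪U t A, A⟫) atTop atTop := by
  obtain ⟨Q, hQF, hAQ⟩ := hA
  exact Mazur1969_inequality.tendsto_integral_atTop hU A Q hQF hAQ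

/-- The value of the limit is positive iff `A` overlaps some conserved vector. [folklore] -/
theorem norm_sq_starProjection_pos_iff (A : E) :
    0 < ‖(invariantSubspace U).starProjection A‖ ^ 2 ↔ ∃ Q ∈ invariantSubspace U, ⟪A, Q⟫ ≠ 0 := by
  rw [sq_pos_iff, norm_ne_zero_iff, Ne, starProjection_eq_zero_iff_forall_inner]
  push Not
  rfl

/-! ### Parity: a reversing symmetry fixing the conserved vectors kills the bound -/

/-- **Parity criterion (time-reversal).** Let `R` be a linear isometry of `E` reversing the
observable, `R A = -A` (the energy current is odd under momentum reversal `p ↦ -p`), and fixing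
every conserved vector (all constants of motion even under `R` — e.g. functions of the energy,
or of the normal-mode energies of a harmonic network with pairwise distinct frequencies). Then
`P A = 0`: Mazur's lower bound and Suzuki's limit vanish identically, whether or not the
dynamics is integrable. Proof: `‖P A‖² = ⟪A, P A⟫ = ⟪R A, R (P A)⟫ = -⟪A, P A⟫`. [folklore] -/
theorem starProjection_eq_zero_of_reversing (R : E →ₗᵢ[ℝ] E) (A : E) (hRA : R A = -A)
    (hRF : ∀ x ∈ invariantSubspace U, R x = x) :
    (invariantSubspace U).starProjection A = 0 := by
  set F := invariantSubspace U
  have hmem : F.starProjection A ∈ F := Submodule.starProjection_apply_mem F A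
  have h1 : ⟪A, F.starProjection A⟫ = ‖F.starProjection A‖ ^ 2 := inner_starProjection_self F A
  have h2 : ⟪A, F.starProjection A⟫ = -⟪A, F.starProjection A⟫ := by
    conv_lhs => rw [← R.inner_map_map A (F.starProjection A), hRA, hRF _ hmem]
    rw [inner_neg_left]
  have h3 : ⟪A, F.starProjection A⟫ = 0 := by linarith
  rw [h1] at h3
  exact norm_eq_zero.mp (pow_eq_zero_iff two_ne_zero |>.mp h3)

/-- Parity criterion, Green–Kubo form: under the hypotheses of
`starProjection_eq_zero_of_reversing` the Cesàro mean of the autocorrelation of `A` tends to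
`0` (no ballistic contribution). [folklore] -/
theorem tendsto_inv_mul_integral_inner_zero_of_reversing (hU : IsContractionSemigroup U)
    (R : E →ₗᵢ[ℝ] E) (A : E) (hRA : R A = -A) (hRF : ∀ x ∈ invariantSubspace U, R x = x) :
    Tendsto (fun τ : ℝ => τ⁻¹ * ∫ t in (0 : ℝ)..τ, ⟪U t A, A⟫) atTop (𝓝 0) := by
  refine tendsto_inv_mul_integral_inner_zero hU A ?_
  exact (starProjection_eq_zero_iff_forall_inner A).mp
    (starProjection_eq_zero_of_reversing R A hRA hRF)

/-! ### Exact subtraction of one conserved quantity (the momentum term) -/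

omit [CompleteSpace E] in
/-- The subtracted observable `Ã = A - (⟪A, Q⟫/‖Q‖²) Q` (LLP's shifted flux
`J̃ = J - (⟨Q₁J⟩/⟨Q₁²⟩) Q₁`) is orthogonal to `Q`. [cite: LepriLiviPoliti2003, §8] -/
theorem inner_sub_div_smul_self (A Q : E) (hQ0 : Q ≠ 0) :
    ⟪A - (⟪A, Q⟫ / ‖Q‖ ^ 2) • Q, Q⟫ = 0 := by
  have hQ : ‖Q‖ ^ 2 ≠ 0 := pow_ne_zero 2 (norm_ne_zero_iff.mpr hQ0)
  rw [inner_sub_left, real_inner_smul_left, real_inner_self_eq_norm_sq, div_mul_cancel₀ _ hQ,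
    sub_self]

/-- **Exact subtraction.** For a conserved `Q ≠ 0`, Suzuki's limit splits EXACTLY:
`‖P A‖² = ‖P Ã‖² + ⟪A, Q⟫²/‖Q‖²` with `Ã = A - (⟪A, Q⟫/‖Q‖²) Q`. With `Q = P` the total momentum
this is "removing the contribution of `Q₁` in the right hand side of the Mazur inequality"
(LLP 2003 §8): the Prosen–Campbell divergence is precisely the term `⟪J, P⟫²/‖P‖²`, and what
is left for the subtracted flux is again Suzuki's limit, about which momentum conservation
says nothing. [cite: LepriLiviPoliti2003, §8] -/
theorem norm_sq_starProjection_eq_add (Q : E) (hQF : Q ∈ invariantSubspace U) (hQ0 : Q ≠ 0)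
    (A : E) :
    ‖(invariantSubspace U).starProjection A‖ ^ 2 =
      ‖(invariantSubspace U).starProjection (A - (⟪A, Q⟫ / ‖Q‖ ^ 2) • Q)‖ ^ 2
        + ⟪A, Q⟫ ^ 2 / ‖Q‖ ^ 2 := by
  set F := invariantSubspace U
  set c : ℝ := ⟪A, Q⟫ / ‖Q‖ ^ 2 with hc
  have hQ : ‖Q‖ ^ 2 ≠ 0 := pow_ne_zero 2 (norm_ne_zero_iff.mpr hQ0)
  have hPQ : F.starProjection Q = Q := Submodule.starProjection_eq_self_iff.mpr hQF
  have hsplit : F.starProjection A = F.starProjection (A - c • Q) + c • Q := by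
    rw [map_sub, map_smul, hPQ, sub_add_cancel]
  have horth : ⟪F.starProjection (A - c • Q), c • Q⟫ = 0 := by
    rw [Submodule.inner_starProjection_left_eq_right, map_smul, hPQ, real_inner_smul_right,
      inner_sub_div_smul_self A Q hQ0, mul_zero]
  have hnorm : ‖c • Q‖ ^ 2 = ⟪A, Q⟫ ^ 2 / ‖Q‖ ^ 2 := by
    rw [norm_smul, mul_pow, Real.norm_eq_abs, sq_abs, hc]
    field_simp
  rw [hsplit, norm_add_sq_real, horth, mul_zero, add_zero, hnorm]

/-! ### Coboundary observables: currents that are time derivatives are Mazur-silent -/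

omit [CompleteSpace E] in
/-- **Coboundary criterion.** If the observable `A` is a time derivative along the dynamics — there
is `X : E` with `∫₀^τ U t A dt = U τ X - X` for all `τ ≥ 0` (for a Koopman semigroup: `A = L X`,
`L` the Liouville operator, e.g. `A = {X, H}`) — then the time averages of `A` are
`τ⁻¹ (U τ X - X)`, of norm `≤ 2‖X‖/τ`. Instances: (i) the total energy current of every finite
OPEN (free or fixed ends) chain `H = ∑ p_i²/2 + U(q_i) + V(q_{i+1} - q_i)`, isolated, is
`J = ∑_{i<N} j_{i,i+1} = d/dt ∑_i i·h_i` (local energy balance `ḣ_i = j_{i-1,i} - j_{i,i+1}`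
summed by parts, the boundary currents being absent), whatever `U`, `V`, `N`; (ii) the
disordered pinned harmonic chain, where `-A_har u_N = J_{N,har}` with `u_N` quadratic and
bounded in `L²` uniformly in `N` [Bernardin–Huveneers 2013, Lemma 1]. [folklore]
[cite: BernardinHuveneers2013, §4 Lemma 1] -/
theorem norm_timeAverage_le_of_coboundary {A X : E}
    (hX : ∀ τ : ℝ, 0 ≤ τ → ∫ t in (0 : ℝ)..τ, U t A = U τ X - X) (hU : IsContractionSemigroup U)
    {τ : ℝ} (hτ : 0 < τ) : ‖timeAverage U τ A‖ ≤ τ⁻¹ * (2 * ‖X‖) := by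
  unfold timeAverage
  rw [hX τ hτ.le, norm_smul, norm_inv, Real.norm_of_nonneg hτ.le]
  gcongr
  calc ‖U τ X - X‖ ≤ ‖U τ X‖ + ‖X‖ := norm_sub_le _ _
    _ ≤ ‖X‖ + ‖X‖ := by gcongr; exact norm_apply_le hU hτ.le X
    _ = 2 * ‖X‖ := by ring

/-- **Coboundary observables have zero Drude weight**: under the coboundary hypothesis `P A = 0`
(the time averages tend both to `P A` and to `0`), hence Suzuki's limit and every Mazur bound
for `A` vanish — for the open finite chain of instance (i) at EVERY `N`, for EVERY interaction,
integrable or not: "for systems with open boundary conditions … the coefficient of the zero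
frequency delta peak is identically zero for any finite system, regardless of its integrability"
(the quantum statement, `J = i[X, H]`). [cite: RigolShastry2008, Abstract and p. 2] -/
theorem starProjection_eq_zero_of_coboundary (hU : IsContractionSemigroup U) {A X : E}
    (hX : ∀ τ : ℝ, 0 ≤ τ → ∫ t in (0 : ℝ)..τ, U t A = U τ X - X) :
    (invariantSubspace U).starProjection A = 0 := by
  have h1 := tendsto_timeAverage hU A
  have h2 : Tendsto (fun τ => timeAverage U τ A) atTop (𝓝 0) := by
    rw [tendsto_zero_iff_norm_tendsto_zero]
    have hlim : Tendsto (fun τ : ℝ => τ⁻¹ * (2 * ‖X‖)) atTop (𝓝 0) := by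
      simpa using tendsto_inv_atTop_zero.mul_const (2 * ‖X‖)
    refine squeeze_zero' (Eventually.of_forall fun τ => norm_nonneg _) ?_ hlim
    filter_upwards [eventually_gt_atTop 0] with τ hτ
      using norm_timeAverage_le_of_coboundary hX hU hτ
  exact tendsto_nhds_unique h1 h2

/-- **Coboundary observables have a BOUNDED Green–Kubo integral**: under the coboundary
hypothesis `|∫₀^τ ⟪U t A, A⟫ dt| ≤ 2‖X‖‖A‖` for all `τ ≥ 0` — not merely `o(τ)`: at fixed size
the Green–Kubo integral of the open chain's current neither grows linearly (ballistic) nor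
sub-linearly (anomalous); all information on the conductivity sits in the `N`-dependence of
`‖X_N‖` (`∼ N^{3/2}` for `X = ∑ i·h_i`; bounded uniformly in `N` for the localised chain of
instance (ii): "the unperturbed chain behaves like a perfect insulator: the current integrated
over arbitrarily long times remains bounded in `L²`" [Bernardin–Huveneers 2013, Thm 1,
Remark 1]). [cite: BernardinHuveneers2013, §2.2 Thm 1 Remark 1] -/
theorem abs_integral_inner_le_of_coboundary (hU : IsContractionSemigroup U) {A X : E}
    (hX : ∀ τ : ℝ, 0 ≤ τ → ∫ t in (0 : ℝ)..τ, U t A = U τ X - X) {τ : ℝ} (hτ : 0 ≤ τ) :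
    |∫ t in (0 : ℝ)..τ, ⟪U t A, A⟫| ≤ 2 * ‖X‖ * ‖A‖ := by
  have h1 : ∫ t in (0 : ℝ)..τ, ⟪U t A, A⟫ = ⟪∫ t in (0 : ℝ)..τ, U t A, A⟫ := by
    have h := inv_mul_integral_inner_eq hU τ A
    by_cases hτ0 : τ = 0
    · subst hτ0; simp
    · have hτne : (τ : ℝ)⁻¹ ≠ 0 := inv_ne_zero hτ0
      unfold timeAverage at h
      rw [real_inner_smul_left] at h
      exact mul_left_cancel₀ hτne h
  rw [h1, hX τ hτ]
  calc |⟪U τ X - X, A⟫| ≤ ‖U τ X - X‖ * ‖A‖ := abs_real_inner_le_norm _ _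
    _ ≤ (‖U τ X‖ + ‖X‖) * ‖A‖ := by gcongr; exact norm_sub_le _ _
    _ ≤ (‖X‖ + ‖X‖) * ‖A‖ := by gcongr; exact norm_apply_le hU hτ X
    _ = 2 * ‖X‖ * ‖A‖ := by ring

end Mazur

/-! ### Fixed size versus thermodynamic limit: a schema -/

namespace Mazur.FixedSize

open Matrix

/-- The diagonal weights `(e^{-t⁺}, 1)`: one decaying mode, one conserved mode. [folklore] -/
def weight (t : ℝ) : Fin 2 → ℝ := ![Real.exp (-(max t 0)), 1]

/-- The two-mode semigroup `U₂ t = diag(e^{-t⁺}, 1)` on `ℝ²` (a Markov-type contraction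
semigroup: mode `0` relaxes, mode `1` is conserved). [folklore] -/
def U₂ (t : ℝ) : EuclideanSpace ℝ (Fin 2) →L[ℝ] EuclideanSpace ℝ (Fin 2) :=
  Matrix.toEuclideanCLM (n := Fin 2) (𝕜 := ℝ) (Matrix.diagonal (weight t))

/-- Coordinates of `U₂ t x`. [folklore] -/
theorem U₂_apply (t : ℝ) (x : EuclideanSpace ℝ (Fin 2)) (i : Fin 2) :
    (U₂ t x) i = weight t i * x i := by
  show (Matrix.diagonal (weight t) *ᵥ x.ofLp) i = _
  rw [mulVec_diagonal]

/-- The weights lie in `[0, 1]`. [folklore] -/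
theorem weight_mem (t : ℝ) (i : Fin 2) : 0 ≤ weight t i ∧ weight t i ≤ 1 := by
  fin_cases i
  · refine ⟨Real.exp_nonneg _, ?_⟩
    show Real.exp (-(max t 0)) ≤ 1
    rw [Real.exp_le_one_iff]
    exact neg_nonpos.mpr (le_max_right t 0)
  · exact ⟨zero_le_one, le_rfl⟩

/-- `U₂` is a strongly continuous contraction semigroup in the sense of this file. [folklore] -/
theorem isContractionSemigroup_U₂ : IsContractionSemigroup U₂ where
  map_add s t hs ht := by
    -- the conserved weight multiplies, the decaying one adds exponents
    have hst : 0 ≤ s + t := add_nonneg hs ht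
    have hw : weight (s + t) = fun i => weight s i * weight t i := by
      funext i
      fin_cases i
      · show Real.exp (-(max (s + t) 0)) = Real.exp (-(max s 0)) * Real.exp (-(max t 0))
        rw [max_eq_left hst, max_eq_left hs, max_eq_left ht, ← Real.exp_add]
        ring_nf
      · show (1 : ℝ) = 1 * 1
        norm_num
    rw [← ContinuousLinearMap.mul_def, U₂, U₂, U₂, ← map_mul, diagonal_mul_diagonal, hw]
  norm_le t _ := by
    refine ContinuousLinearMap.opNorm_le_bound _ zero_le_one fun x => ?_
    rw [one_mul]
    apply le_of_sq_le_sq _ (norm_nonneg x)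
    rw [EuclideanSpace.real_norm_sq_eq, EuclideanSpace.real_norm_sq_eq]
    refine Finset.sum_le_sum fun i _ => ?_
    rw [U₂_apply, mul_pow]
    have h := weight_mem t i
    have hw : weight t i ^ 2 ≤ 1 := pow_le_one₀ h.1 h.2
    calc weight t i ^ 2 * x i ^ 2 ≤ 1 * x i ^ 2 := mul_le_mul_of_nonneg_right hw (sq_nonneg _)
      _ = x i ^ 2 := one_mul _
  continuous x := by
    have : (fun t => U₂ t x) = fun t => WithLp.toLp 2 (fun i => weight t i * x i) := by
      funext t
      ext i
      rw [U₂_apply]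
    rw [this]
    refine (PiLp.continuous_toLp 2 _).comp (continuous_pi fun i => ?_)
    fin_cases i
    · show Continuous fun t => Real.exp (-(max t 0)) * x 0
      fun_prop
    · show Continuous fun t => (1 : ℝ) * x 1
      fun_prop

/-- The conserved mode `e₁`. [folklore] -/
def e₁ : EuclideanSpace ℝ (Fin 2) := EuclideanSpace.single 1 1

/-- The observable family `A c = e₀ + c • e₁`: unit weight on the relaxing mode, weight `c` on
the conserved one (per-site Drude weight `c²`, think `c² ∼ 1/N`). [folklore] -/
def A (c : ℝ) : EuclideanSpace ℝ (Fin 2) := WithLp.toLp 2 ![1, c]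

/-- `e₁` is conserved by `U₂`. [folklore] -/
theorem e₁_mem_invariantSubspace : e₁ ∈ invariantSubspace U₂ := by
  intro t _
  ext i
  rw [U₂_apply]
  fin_cases i
  · simp [e₁]
  · simp [e₁, weight]

/-- `⟪A c, e₁⟫ = c`. [folklore] -/
theorem inner_A_e₁ (c : ℝ) : ⟪A c, e₁⟫ = c := by
  simp [A, e₁, EuclideanSpace.inner_single_right]

/-- The autocorrelation of `A c`: `⟪U₂ t (A c), A c⟫ = e^{-t} + c²` for `t ≥ 0`. [folklore] -/
theorem inner_U₂_A (c : ℝ) {t : ℝ} (ht : 0 ≤ t) :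
    ⟪U₂ t (A c), A c⟫ = Real.exp (-t) + c ^ 2 := by
  rw [real_inner_comm, U₂, Matrix.inner_toEuclideanCLM]
  simp [A, weight, mulVec_diagonal, dotProduct, Fin.sum_univ_two, max_eq_left ht, sq]

/-- The finite-size Green–Kubo integral: `∫₀^τ ⟪U₂ t (A c), A c⟫ dt = (1 - e^{-τ}) + c² τ` for
`τ ≥ 0`. [folklore] -/
theorem integral_inner_U₂_A (c : ℝ) {τ : ℝ} (hτ : 0 ≤ τ) :
    ∫ t in (0 : ℝ)..τ, ⟪U₂ t (A c), A c⟫ = (1 - Real.exp (-τ)) + c ^ 2 * τ := by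
  have h1 : ∫ t in (0 : ℝ)..τ, ⟪U₂ t (A c), A c⟫ =
      ∫ t in (0 : ℝ)..τ, (Real.exp (-t) + c ^ 2) := by
    refine intervalIntegral.integral_congr fun t ht => ?_
    rw [Set.uIcc_of_le hτ] at ht
    exact inner_U₂_A c ht.1
  rw [h1, intervalIntegral.integral_add
    ((by fun_prop : Continuous fun t : ℝ => Real.exp (-t)).intervalIntegrable _ _)
    (continuous_const.intervalIntegrable _ _), intervalIntegral.integral_const,
    intervalIntegral.integral_comp_neg (fun t => Real.exp t), integral_exp]
  simp
  ring

/-- **Fixed-size schema.** A contraction semigroup `U` on `ℝ²`, a conserved `Q`, and observables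
`A_N` (`N ∈ ℕ`) such that: every `A_N` overlaps `Q` (so the catalogued corollary
`Mazur1969_inequality.tendsto_integral_atTop` fires at EVERY `N`: `∫₀^τ ⟪U t A_N, A_N⟫ dt → ∞`
linearly, with Drude weight `lim_τ τ⁻¹∫₀^τ = (N+1)⁻² > 0`), yet the thermodynamic Green–Kubo
limit — `N → ∞` FIRST, then `τ → ∞`, the printed order [LLP 2003 §5.2] — is finite and positive:
`lim_N ∫₀^τ ⟪U t A_N, A_N⟫ dt = 1 - e^{-τ} → 1`. A logical separation (the fixed-size theorem
does not see the conductivity), mirroring "`D_L` and `D*_L` are expected to exponentially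
vanish with the system size for nonintegrable systems" although non-zero at each `L`
[Rigol–Shastry 2008 p. 2, citing Castella–Zotos–Prelovšek 1995 and Heidrich-Meisner et al.
2003]. [cite: LepriLiviPoliti2003, §5.2] [cite: RigolShastry2008, p. 2] -/
theorem fixedSize_schema :
    ∃ (U : ℝ → EuclideanSpace ℝ (Fin 2) →L[ℝ] EuclideanSpace ℝ (Fin 2))
      (_ : IsContractionSemigroup U) (Q : EuclideanSpace ℝ (Fin 2))
      (A : ℕ → EuclideanSpace ℝ (Fin 2)),
      Q ∈ invariantSubspace U ∧ (∀ N, ⟪A N, Q⟫ ≠ 0) ∧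
      (∀ N, Tendsto (fun τ : ℝ => ∫ t in (0 : ℝ)..τ, ⟪U t (A N), A N⟫) atTop atTop) ∧
      (∀ N, Tendsto (fun τ : ℝ => τ⁻¹ * ∫ t in (0 : ℝ)..τ, ⟪U t (A N), A N⟫) atTop
        (𝓝 (((N : ℝ) + 1)⁻¹ ^ 2))) ∧
      (∀ τ : ℝ, 0 ≤ τ → Tendsto (fun N : ℕ => ∫ t in (0 : ℝ)..τ, ⟪U t (A N), A N⟫) atTop
        (𝓝 (1 - Real.exp (-τ)))) ∧
      Tendsto (fun τ : ℝ => 1 - Real.exp (-τ)) atTop (𝓝 1) := by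
  refine ⟨U₂, isContractionSemigroup_U₂, e₁, fun N => A (((N : ℝ) + 1)⁻¹),
    e₁_mem_invariantSubspace, fun N => ?_, fun N => ?_, fun N => ?_, fun τ hτ => ?_, ?_⟩
  · rw [inner_A_e₁]; positivity
  · exact Mazur1969_inequality.tendsto_integral_atTop isContractionSemigroup_U₂ _ e₁
      e₁_mem_invariantSubspace (by rw [inner_A_e₁]; positivity)
  · -- Drude weight at fixed `N`: `τ⁻¹((1 - e^{-τ}) + c²τ) → c²`
    set c : ℝ := ((N : ℝ) + 1)⁻¹
    have h1 : Tendsto (fun τ : ℝ => τ⁻¹ * (1 - Real.exp (-τ)) + c ^ 2) atTop (𝓝 (0 + c ^ 2)) := by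
      refine Tendsto.add ?_ tendsto_const_nhds
      have hb : Tendsto (fun τ : ℝ => τ⁻¹ * 2) atTop (𝓝 0) := by
        simpa using tendsto_inv_atTop_zero.mul_const (2 : ℝ)
      refine squeeze_zero' ?_ ?_ hb
      · filter_upwards [eventually_gt_atTop 0] with τ hτ
        have he : Real.exp (-τ) ≤ 1 := Real.exp_le_one_iff.mpr (by linarith)
        exact mul_nonneg (inv_nonneg.mpr hτ.le) (by linarith)
      · filter_upwards [eventually_gt_atTop 0] with τ hτ
        have he : 0 ≤ Real.exp (-τ) := Real.exp_nonneg _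
        gcongr
        linarith
    rw [zero_add] at h1
    refine h1.congr' ?_
    filter_upwards [eventually_gt_atTop 0] with τ hτ
    rw [integral_inner_U₂_A c hτ.le]
    field_simp
  · -- thermodynamic limit at fixed `τ`: `(1 - e^{-τ}) + (N+1)⁻² τ → 1 - e^{-τ}`
    have h0 : Tendsto (fun N : ℕ => ((N : ℝ) + 1)⁻¹) atTop (𝓝 0) := by
      simpa using tendsto_one_div_add_atTop_nhds_zero_nat (𝕜 := ℝ)
    have h1 : Tendsto (fun N : ℕ => (1 - Real.exp (-τ)) + ((N : ℝ) + 1)⁻¹ ^ 2 * τ) atTop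
        (𝓝 ((1 - Real.exp (-τ)) + 0 ^ 2 * τ)) :=
      tendsto_const_nhds.add ((h0.pow 2).mul_const τ)
    simp only [ne_eq, OfNat.ofNat_ne_zero, not_false_eq_true, zero_pow, zero_mul,
      add_zero] at h1
    refine h1.congr' (Eventually.of_forall fun N => ?_)
    exact (integral_inner_U₂_A _ hτ).symm
  · have h := (Real.tendsto_exp_neg_atTop_nhds_zero).const_sub 1
    simpa using h

end Mazur.FixedSize

/-! ### The narrowed barrier -/

open Mazur

universe u

/-- **Narrowed barrier (audit of `MazurBoundBallistic`, 2026-08-15): Mazur's bound obstructs exactly an extensive conserved charge, odd under momentum reversal and overlapping the current, of the infinite-volume (or periodic) dynamics — not integrability, not the conservation laws of a finite chain, and nothing at all on finite open chains.** Conjuncts, all PROVED (`MazurBoundBallisticNarrow_holds`), for strongly continuous contraction semigroups `U t` (`t ≥ 0`) on real Hilbert spaces `E` (`Mazur.IsContractionSemigroup U`; `F` the conserved vectors, `P` the orthogonal projection onto `F`): (1) [catalogued: Mazur 1969 / Suzuki 1971] `τ⁻¹∫₀^τ ⟪U t A, A⟫ dt → ‖P A‖²` and `∑_{i∈s} ⟪A,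 Q_i⟫²/‖Q_i‖² ≤ ‖P A‖²` for pairwise orthogonal non-zero conserved `Q_i`; (2) [silence / dichotomy] if `⟪A, Q⟫ = 0` for every `Q ∈ F` the Cesàro mean tends to `0`, and if `⟪A, Q⟫ ≠ 0` for some `Q ∈ F` then `∫₀^τ ⟪U t A, A⟫ dt → +∞`; (3) [parity] for a linear isometry `R` with `R A = -A` fixing `F` pointwise: `P A = 0` and the Cesàro mean tends to `0`; (4) [coboundary] if `∫₀^τ U t A dt = U τ X - X` for all `τ ≥ 0` then `P A = 0` and `|∫₀^τ ⟪U t A, A⟫ dt| ≤ 2‖X‖‖A‖` for all `τ ≥ 0`; (5) [fixed size versus thermodynamic limit] there are a contraction semigroup on `ℝ²`, a conserved `Q` and observables `A_N`, `N ∈ ℕ`, with `⟪A_N, Q⟫ ≠ 0`, `∫₀^τ ⟪U t A_N, A_N⟫ dt → ∞` (`τ → ∞`) and Drude weight `lim_τ τ⁻¹∫₀^τ = (N+1)⁻²` at every `N`, while `∫₀^τ ⟪U t A_N, A_N⟫ dt → 1 - e^{-τ}` as `N → ∞` for every `τ ≥ 0`, and `1 - e^{-τ} → 1`; (6) [exact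 subtraction] for conserved `Q ≠ 0` and `Ã = A - (⟪A, Q⟫/‖Q‖²)Q`: `⟪Ã, Q⟫ = 0` and `‖P A‖² = ‖P Ã‖² + ⟪A, Q⟫²/‖Q‖²`.
BARRIER (D-0021), AtomisticToContinuum/FouriersLaw (supersedes the wording of the block on `Mazur1969_inequality`; that theorem is conjunct (1)):
technique_class: drude-weight-blind green-kubo arguments — arguments for a FINITE thermodynamic Green–Kubo conductivity `κ_GK = lim_t ∫₀ᵗ dτ lim_N N⁻¹⟨J_N(τ)J_N(0)⟩` (infinite volume first) [cite: LepriLiviPoliti2003, §5.2] (or for a bounded `κ_N`) of a chain family that would apply verbatim to a member possessing an EXTENSIVE conserved charge `Q` of the infinite-volume (or periodic, uniformly in `N`) equilibrium dynamics, ODD under momentum reversal `p ↦ -p` — more precisely with `lim inf_N N⁻¹∑_n ⟨J_NQ_n⟩²/⟨Q_n²⟩ > 0`: the periodic ordered harmonic chain (`Q = J` itself), the periodic Toda chain (`Q₃, Q₅, …` in the pressure ensemble; "`Q_n` with even `n` are uncoupled with `J̃`") [cite: Zotos2002, §2] [cite: LepriLiviPoliti2003, §8], unpinned chains at non-zero pressure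 read in the un-truncated canonical Kubo formula (`Q = P`) [cite: ProsenCampbell2000, Theorem]; NOT covered, although inside the catalogued wording "conservation-law-blind integrability-blind … arguments … that do not exclude a conserved quantity `Q` of the bulk dynamics with `⟨JQ⟩ ≠ 0`": (a) integrability per se — an integrable bulk all of whose conserved quantities are EVEN under momentum reversal is Mazur-silent (conjunct (3)): harmonic networks with non-degenerate normal spectrum (the setting of [cite: DharKunduSaito2021, §4.3]; every open harmonic chain with positive-definite force matrix, a Jacobi matrix with simple spectrum), e.g. the disordered pinned harmonic chain, "an integrable system" whose current is a coboundary, "`-A_har u_N = J_{N,har}`" with `(u_N)` bounded in `L²` uniformly in `N`, and which "behaves like a perfect insulator: the current integrated over arbitrarily long times remains bounded in `L²`" [cite: BernardinHuveneers2013, §1, §2.2 Thm 1 Remark 1 and §4 Lemma 1]; (b) the conservation laws of a FINITE chain — at fixed `N` the bound neither implies nor follows from ballistic conduction: on every finite OPEN chain (free or fixed ends) the total current is the time derivative of `∑ i·h_i`, so its Drude weight is `0` and its Green–Kubo integral bounded, for every interaction (conjunct (4); quantum form: "for systems with open boundary conditions … the coefficient of the zero frequency delta peak is identically zero for any finite system,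 regardless of its integrability" [cite: RigolShastry2008, Abstract and p. 2]), while on non-integrable RINGS the finite-size Drude weight is non-zero and "expected to exponentially vanish with the system size" [cite: RigolShastry2008, p. 2] (conjunct (5): divergence at every `N` is compatible with a finite positive `κ_GK`); (c) the conjunct's own chain `pinnedChain ω₂ lam β γ`, `ω₂, lam, β > 0`: the momentum is not conserved, the bulk between the baths is an open chain (b), and no conserved quantity other than the (even) energy is known or expected — for the Toda interaction itself "the presence of the pinning potential is expected to destroy the integrability …, while leaving only one conserved quantity: the total energy", with positive maximal Lyapunov exponent for every pinning power and "normal (diffusive) conductivity for very long chains" [cite: DicintioEtAl2018, Abstract, §2 and §3]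
blocks: (α) [catalogued (a), sharpened] a finite `κ_GK` (printed order of limits) by an argument uniform over a family containing the periodic/infinite Toda chain or the ordered harmonic ring: there the infinite-volume current autocorrelation per site has a positive Cesàro mean, at least the extensive Mazur bound from `Q₃` (product pressure ensemble, local densities; "the long time asymptotic value of the subtracted energy current correlations is finite") [cite: Zotos2002, §2] [cite: LepriLiviPoliti2003, §8], and "this ideal conducting behavior is reflected by the existence of a nonzero flux autocorrelation at arbitrarily large times … the finite-size conductivity diverges linearly with the size" through the transit-time cut-off `Na/v_s` [cite: LepriLiviPoliti2003, §8 and §6.2]; in the tree this bears on `Literature.MathematicalPhysics.KineticTheory.HeatConduction.FouriersLaw` only as "no proof of a finite `κ_GK` uniform in the interaction `V` over a class containing `e^{-r}` at `ω₂ = lam = 0`" — an unpinned Green–Kubo statement the tree does not have (`pinnedChain 0 0 β γ` violates `FouriersLawFor` outright, `FPUBetaKineticAnomalyNarrow` conjunct (3)); (β) [catalogued (b), made exact by conjunct (6)] Prosen–Campbell's divergence of the UN-TRUNCATED canonical Kubo integral at non-zero pressure is precisely the term `⟨JP⟩²/⟨P²⟩` of Suzuki's limit; for the subtracted flux `J̃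 = J - (⟨JP⟩/⟨P²⟩)P` ("equivalent to removing the contribution of `Q₁`" [cite: LepriLiviPoliti2003, §8]) the limit is `‖P J̃‖²`, on which momentum conservation is silent — so (β) blocks only the un-truncated reading, disputed in print [cite: BonettoLebowitzReyBellet2000, §7 footnote] [cite: LepriLiviPoliti2003, §5.2]; NOT blocked by THIS mechanism: the harmonic corner `lam = β = 0` of the conjunct — the isolated free-end chain `pinnedChain ω₂ 0 0 γ` has zero Drude weight at every `N` (b) although it conducts ballistically between baths (companion `HarmonicCrystalBallistic`, on the Rieder–Lebowitz–Lieb / Nakazawa solution): "no proof of `FouriersLaw` uniform in `lam, β ≥ 0`" stands on that companion entry, not on Mazur's bound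
because: Suzuki's equality is exact — the linear-in-`τ` part of the fixed-system Green–Kubo integral is `‖P J‖²` and nothing else (conjuncts (1)–(2); classical form `C_A = ⟨Ā²⟩`, `Ā` the infinite-time average, needing ergodicity on the level sets and, at finite `N`, products of the conserved quantities [cite: DharKunduSaito2021, §3 and §5]); `J` is odd under `p ↦ -p`, so only odd conserved vectors count (conjunct (3); "`Q_n` with even `n` are uncoupled with `J̃`" [cite: LepriLiviPoliti2003, §8]; "`A_2` is odd under time reversal which has non-zero overlap with odd conserved charges or products of conservation charges which are odd" [cite: DharKunduSaito2021, §4.4]); a current that is a time derivative has `P J = 0` and a bounded integrated autocorrelation (conjunct (4)); and the conductivity is a thermodynamic-limit quantity with `N → ∞` first — "the infinite-volume limit should be taken before the long-time limit, in order to avoid the problem of Poincaré recurrences" [cite: LepriLiviPoliti2003, §5.2] — for which the relevant projection is onto the EXTENSIVE conserved charges of the infinite system: "the Drude weight exists and is obtained by projecting onto the space of conserved charges", "Only homogeneous conserved charges contribute", "Effects due to finite volumes of space are avoided by the use of the algebraic formulation of statistical mechanics" [cite: Doyon2022, §5.1 Thm 5.1 and §1] (proved for quantum spin chains; for the periodic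 Toda chain the finite-`N` deficit of the `{Q_n}` Mazur bound "decreases as `1/N`" numerically, "We are not aware of a proof" [cite: DharKunduSaito2021, §4.4 and §5])
evasions_known: (i)–(v) of the catalogued block stand (pinning; fixing `Π = 0` / truncation / `J̃`; coupled rotors; vanishing Drude weight of non-integrable systems; non-acoustic conservative-noise chains) [cite: Dhar2008, §4 and §4.2.2] [cite: LepriLiviPoliti2003, §5.2 and §8] [cite: BasileBernardinJaraKomorowskiOlla2016, §7]; (vi) integrable yet silent — make every conserved quantity even: quench the `k ↔ -k` degeneracy of the harmonic ring by disorder (random pinnings or masses) or merely by open ends (non-degenerate standing-wave spectrum): zero Drude weight (conjuncts (3)–(4)); with disorder a perfect insulator in the Green–Kubo sense [cite: BernardinHuveneers2013, §2.2 Thm 1 Remark 1] and `κ_N → 0` between baths [cite: Dhar2008, §3.4.1] [cite: AjankiHuveneers2011, Thm 1.1]; (vii) pin the integrable interaction: the pinned Toda chain keeps only the energy, is chaotic, and conducts normally in simulations of long chains (long quasi-integrable transients, an `ω^{-5/3}` window for harmonic pinning) [cite: DicintioEtAl2018, Abstract, §3 and §5]; (viii) work on the finite open chain and put the `N`-dependence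 into the antiderivative: `J_N = L X_N` makes the bound identically silent (conjunct (4)), and conduction is read off the growth of `‖X_N‖` — bounded uniformly in `N` for the localised chain [cite: BernardinHuveneers2013, §4 Lemma 1], `∼ N^{3/2}` for `X = ∑ i·h_i` in general
scope_caveats: (a) every conjunct is a theorem about contraction semigroups on real Hilbert spaces; the chain-level instances — `J = (d/dt)∑ i·h_i` on open chains (local energy balance summed by parts), "all invariants even" for harmonic networks with pairwise distinct non-resonant frequencies (time averages of `Q_kP_l` vanish along the explicit solution), `R = (p ↦ -p)^*` on `L²(μ_eq)` — are informal dictionary entries, as in the catalogued block, and strong continuity, `L²`-membership of `X` and the mild form `∫₀^τ U t J = U τ X - X` are left to the user; (b) conjunct (5) is a logical separation on `ℝ²`, not a chain; the finite-size statements it mirrors are numerical/heuristic for classical chains [cite: DharKunduSaito2021, §4.4] and theorems in infinite volume only for quantum spin chains [cite: Doyon2022, Thm 2.2]; (c) NOTHING here weakens the obstruction for periodic/infinite integrable interactions with odd extensive charges (Toda, ordered harmonic ring): blocks (α) stands; but even there the rigorous thermodynamic statement for the classical Toda chain (exchange of `N → ∞` with `τ → ∞`; unbounded interactions, no Lieb–Robinson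 bound) is not in print as a theorem — the extensive bound itself is an elementary product-measure computation [cite: Zotos2002, §2]; (d) all caveats of the catalogued entry stand: equilibrium Green–Kubo statements only, whose bearing on the bath-driven `κ = lim N·J_N/δT` of `OscillatorChain.FouriersLawFor` rests on the unproved `κ = κ_GK` [cite: BonettoLebowitzReyBellet2000, §7]; Mazur 1969 and Suzuki 1971 not re-read (paywalled; restatements [cite: LepriLiviPoliti2003, §8] [cite: DharKunduSaito2021, §3] used)
status: conjunct (1) theorem (Mazur 1969 / Suzuki 1971; proved in the tree); conjuncts (2)–(6) proved (this file); the infinite-volume projection formula is a theorem for quantum spin chains [cite: Doyon2022, Thm 5.1] and numerically supported, unproved, for classical anharmonic chains [cite: DharKunduSaito2021, §5]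
[cite: Mazur1969, inequality as restated in LepriLiviPoliti2003 §8] [cite: LepriLiviPoliti2003, §5.2 and §8] [cite: RigolShastry2008, Abstract and p. 2] [cite: BernardinHuveneers2013, §2.2 Thm 1 Remark 1 and §4 Lemma 1] -/
def MazurBoundBallisticNarrow : Prop :=
  -- (1) Mazur 1969 / Suzuki 1971, as catalogued, with the value of the limit
  (∀ (E : Type u) [NormedAddCommGroup E] [InnerProductSpace ℝ E] [CompleteSpace E]
      (U : ℝ → E →L[ℝ] E), IsContractionSemigroup U → ∀ A : E,
      Tendsto (fun τ : ℝ => τ⁻¹ * ∫ t in (0 : ℝ)..τ, ⟪U t A, A⟫) atTop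
        (𝓝 (‖(invariantSubspace U).starProjection A‖ ^ 2)) ∧
      ∀ (ι : Type u) (s : Finset ι) (Q : ι → E), (∀ i ∈ s, Q i ∈ invariantSubspace U) →
        (∀ i ∈ s, Q i ≠ 0) → (∀ i ∈ s, ∀ j ∈ s, i ≠ j → ⟪Q i, Q j⟫ = 0) →
        ∑ i ∈ s, ⟪A, Q i⟫ ^ 2 / ‖Q i‖ ^ 2 ≤ ‖(invariantSubspace U).starProjection A‖ ^ 2) ∧
  -- (2) silence / dichotomy
  (∀ (E : Type u) [NormedAddCommGroup E] [InnerProductSpace ℝ E] [CompleteSpace E]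
      (U : ℝ → E →L[ℝ] E), IsContractionSemigroup U → ∀ A : E,
      ((∀ Q ∈ invariantSubspace U, ⟪A, Q⟫ = 0) →
        Tendsto (fun τ : ℝ => τ⁻¹ * ∫ t in (0 : ℝ)..τ, ⟪U t A, A⟫) atTop (𝓝 0)) ∧
      ((∃ Q ∈ invariantSubspace U, ⟪A, Q⟫ ≠ 0) →
        Tendsto (fun τ : ℝ => ∫ t in (0 : ℝ)..τ, ⟪U t A, A⟫) atTop atTop)) ∧
  -- (3) parity
  (∀ (E : Type u) [NormedAddCommGroup E] [InnerProductSpace ℝ E] [CompleteSpace E]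
      (U : ℝ → E →L[ℝ] E), IsContractionSemigroup U → ∀ (R : E →ₗᵢ[ℝ] E) (A : E),
      R A = -A → (∀ x ∈ invariantSubspace U, R x = x) →
      (invariantSubspace U).starProjection A = 0 ∧
        Tendsto (fun τ : ℝ => τ⁻¹ * ∫ t in (0 : ℝ)..τ, ⟪U t A, A⟫) atTop (𝓝 0)) ∧
  -- (4) coboundary (time-derivative) observables
  (∀ (E : Type u) [NormedAddCommGroup E] [InnerProductSpace ℝ E] [CompleteSpace E]
      (U : ℝ → E →L[ℝ] E), IsContractionSemigroup U → ∀ A X : E,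
      (∀ τ : ℝ, 0 ≤ τ → ∫ t in (0 : ℝ)..τ, U t A = U τ X - X) →
      (invariantSubspace U).starProjection A = 0 ∧
        ∀ τ : ℝ, 0 ≤ τ → |∫ t in (0 : ℝ)..τ, ⟪U t A, A⟫| ≤ 2 * ‖X‖ * ‖A‖) ∧
  -- (5) fixed size versus thermodynamic limit (schema on `ℝ²`)
  (∃ (U : ℝ → EuclideanSpace ℝ (Fin 2) →L[ℝ] EuclideanSpace ℝ (Fin 2))
      (_ : IsContractionSemigroup U) (Q : EuclideanSpace ℝ (Fin 2))
      (A : ℕ → EuclideanSpace ℝ (Fin 2)),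
      Q ∈ invariantSubspace U ∧ (∀ N, ⟪A N, Q⟫ ≠ 0) ∧
      (∀ N, Tendsto (fun τ : ℝ => ∫ t in (0 : ℝ)..τ, ⟪U t (A N), A N⟫) atTop atTop) ∧
      (∀ N, Tendsto (fun τ : ℝ => τ⁻¹ * ∫ t in (0 : ℝ)..τ, ⟪U t (A N), A N⟫) atTop
        (𝓝 (((N : ℝ) + 1)⁻¹ ^ 2))) ∧
      (∀ τ : ℝ, 0 ≤ τ → Tendsto (fun N : ℕ => ∫ t in (0 : ℝ)..τ, ⟪U t (A N), A N⟫) atTop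
        (𝓝 (1 - Real.exp (-τ)))) ∧
      Tendsto (fun τ : ℝ => 1 - Real.exp (-τ)) atTop (𝓝 1)) ∧
  -- (6) exact subtraction of one conserved quantity
  (∀ (E : Type u) [NormedAddCommGroup E] [InnerProductSpace ℝ E] [CompleteSpace E]
      (U : ℝ → E →L[ℝ] E) (Q : E), Q ∈ invariantSubspace U → Q ≠ 0 → ∀ A : E,
      ⟪A - (⟪A, Q⟫ / ‖Q‖ ^ 2) • Q, Q⟫ = 0 ∧
      ‖(invariantSubspace U).starProjection A‖ ^ 2 =
        ‖(invariantSubspace U).starProjection (A - (⟪A, Q⟫ / ‖Q‖ ^ 2) • Q)‖ ^ 2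
          + ⟪A, Q⟫ ^ 2 / ‖Q‖ ^ 2)

/-- **The narrowed barrier holds** (all six conjuncts are theorems of the tree).
[cite: Mazur1969, inequality as restated in LepriLiviPoliti2003 §8] -/
theorem MazurBoundBallisticNarrow_holds : MazurBoundBallisticNarrow.{u} := by
  refine ⟨?_, ?_, ?_, ?_, Mazur.FixedSize.fixedSize_schema, ?_⟩
  · intro E _ _ _ U hU A
    exact ⟨tendsto_inv_mul_integral_inner hU A,
      fun ι s Q hQF hQ0 hQorth => sum_sq_inner_div_le s Q hQF hQ0 hQorth A⟩
  · intro E _ _ _ U hU A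
    exact ⟨tendsto_inv_mul_integral_inner_zero hU A, tendsto_integral_inner_atTop_of_exists hU A⟩
  · intro E _ _ _ U hU R A hRA hRF
    exact ⟨starProjection_eq_zero_of_reversing R A hRA hRF,
      tendsto_inv_mul_integral_inner_zero_of_reversing hU R A hRA hRF⟩
  · intro E _ _ _ U hU A X hX
    exact ⟨starProjection_eq_zero_of_coboundary hU hX,
      fun τ hτ => abs_integral_inner_le_of_coboundary hU hX hτ⟩
  · intro E _ _ _ U Q hQF hQ0 A
    exact ⟨inner_sub_div_smul_self A Q hQ0, norm_sq_starProjection_eq_add Q hQF hQ0 A⟩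

/-- The catalogued theorem's statement (index types in the universe of `E`) is recovered from
conjunct (1) of the narrowed barrier. [cite: Mazur1969, inequality as restated in LepriLiviPoliti2003 §8] -/
theorem Mazur1969_inequality_of_narrow (h : MazurBoundBallisticNarrow.{u})
    {E : Type u} [NormedAddCommGroup E] [InnerProductSpace ℝ E] [CompleteSpace E]
    {U : ℝ → E →L[ℝ] E} (hU : IsContractionSemigroup U) (A : E) {ι : Type u} (s : Finset ι)
    (Q : ι → E) (hQF : ∀ i ∈ s, Q i ∈ invariantSubspace U) (hQ0 : ∀ i ∈ s, Q i ≠ 0)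
    (hQorth : ∀ i ∈ s, ∀ j ∈ s, i ≠ j → ⟪Q i, Q j⟫ = 0) :
    ∃ D : ℝ, Tendsto (fun τ : ℝ => τ⁻¹ * ∫ t in (0 : ℝ)..τ, ⟪U t A, A⟫) atTop (𝓝 D) ∧
      ∑ i ∈ s, ⟪A, Q i⟫ ^ 2 / ‖Q i‖ ^ 2 ≤ D :=
  ⟨_, (h.1 E U hU A).1, (h.1 E U hU A).2 ι s Q hQF hQ0 hQorth⟩

/-- Conjunct (4), read back for the tree's geometry: an observable that is a time derivative
along a contraction semigroup (the total current `J = (d/dt)∑ i·h_i` of any finite open chain)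
has zero Drude weight — the catalogued corollary `Mazur1969_inequality.tendsto_integral_atTop`
has no instance `A = J` there, since `⟪J, Q⟫ = 0` for every conserved `Q`. [folklore] -/
theorem MazurBoundBallisticNarrow.inner_eq_zero_of_coboundary (h : MazurBoundBallisticNarrow.{u})
    {E : Type u} [NormedAddCommGroup E] [InnerProductSpace ℝ E] [CompleteSpace E]
    {U : ℝ → E →L[ℝ] E} (hU : IsContractionSemigroup U) {A X : E}
    (hX : ∀ τ : ℝ, 0 ≤ τ → ∫ t in (0 : ℝ)..τ, U t A = U τ X - X) :
    ∀ Q ∈ invariantSubspace U, ⟪A, Q⟫ = 0 :=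
  (starProjection_eq_zero_iff_forall_inner A).mp (h.2.2.2.1 E U hU A X hX).1

end Literature.Barriers.AtomisticToContinuum

end
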